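import Literature.NumberTheory.DiophantineGeometry.DetOrbitSymKroneckerBoundEval
import Literature.Computability.AlgebraicComplexity.PlethysmLengthVanishing
import Literature.Computability.AlgebraicComplexity.MultiplicityObstructionsProofs
import Literature.Computability.AlgebraicComplexity.PerDetMultiplicityObstruction
import Literature.Computability.Complexity.OccurrenceObstructionsIP
import HarnessLib

/-!
# The BLMW ceiling `sk(λ, 4 × d)` is NOT attained by `Δ(det₄)` at the rectangular weight
# `λ = (1¹⁶)`, `d = 4`: `mult_{(1¹⁶)*} ℂ[Δ(det₄)]₄ = 0 < 1 = sk((1¹⁶), 4 × 4)` — kernel theorem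

Cell `val-lit` (D-0074 GROUP L), BIP corpus, GAP-LEDGER row BI17 (Bürgisser–Ikenmeyer 2017,
*Fundamental invariants of orbit closures*), discharge target **W2** of `run/shared/lean/pub/val-lit/bip/
GAP-LEDGER-rows.md`: the DERIVED row Prop

  `BI17Det4ClosureLtOrbit : ∃ (d : ℕ) (λ : Nat.Partition (4 * d)), λ.parts.card ≤ 4 * 4 ∧
     orbitMultiplicity ℂ (detFormLex ℂ 4) 4 (Weight.dualOfPartition (4 * 4) λ).toMatIdx <
       symKroneckerCoeffRect ℂ 4 d λ`

("the BLMW ceiling (5.2.7) `mult_{π*} ℂ[Δ(det_n)]_δ ≤ sk^π_{δⁿδⁿ}` is not attained at `det₄` at some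
rectangular weight of degree `< 16 = e(det₄)`"), proved here UNCONDITIONALLY (no BI17 named fact is
used) at the witness `(d, λ) = (4, (1¹⁶))` — `bi17Det4ClosureLtOrbit` below is that statement verbatim.

HONEST FRAMING. `VP ≠ VNP` is NOT proved here or anywhere in the tree, and nothing in this file is
progress on it; `(3, 4)` / `det₄` is method validation at a KNOWN separation. The weight `(1¹⁶)*` is
NOT an obstruction of any kind for `(X₀₀ per₃, det₄)`: BOTH orbit-closure multiplicities vanish in
degree `4` (`orbitMultiplicity_paddedPer_ones16_eq_zero`, `not_perDetMultiplicityObstruction_ones16`).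
What the row records is only the det-side phenomenon BI17 §3.1–§3.2 isolates (`b(det₄) = 4 < 16 =
e(det₄)`: the ORBIT `GL₁₆ · det₄` carries a nonzero `SL₁₆`-semi-invariant regular function of degree
`4`, dimension `sk((1¹⁶), 4 × 4) = 1` by BLMW Prop. 5.2.1 (5.2.6), while the orbit CLOSURE has no
`SL₁₆`-invariant of degree `< 16`), in the tree's numerical vocabulary: det-side upper bounds strictly
below `sk` exist, so `sk`-free det₄ bounds (ideal highest-weight-vector censuses, chain link (h) of
`Theorems/BIPWhatWouldSufficeTyped.lean`) are worth running.

## Results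

* `skSumT_sixteen_ones_rect44` — the class sum `MNEval.skSumT 16 [16] [4,4,4,4] = 2·16!·1` over the
  `231` classes of `𝔖₁₆`, ONE `decide +kernel` (Murnaghan–Nakayama in the kernel, the pub-gct
  certificate pattern of `Summits/PneNP/GCT/Certificates/DetSideSk*.lean`);
* `symKroneckerCoeffRect_four_four_ones16 : sk((1¹⁶), 4 × 4) = 1` — the sign character of `𝔖₁₆` lies
  in `S²[4⁴]` (not in `Λ²[4⁴]`), by the tree's PROVED semantics `symKroneckerCoeffRect_eq_of_skSumT_eq`
  (BLMW (5.2.5), Fulton–Harris Ex. 4.51);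
* `orbitMultiplicity_eq_zero_of_lt_card_parts` — for ANY form `f` of degree `n ≠ 0` on the `m²`
  lexicographic matrix variables and `λ ⊢ d·n` with more than `d` (and at most `m²`) parts,
  `mult_{λ*} k[Δ_n(f)] = 0`: BLMW's plethysm bound (`orbitMultiplicity_le_plethysmCoeff_holds`) and
  the classical length vanishing `a_λ(d[n]) = 0` for `ℓ(λ) > d` (Macdonald I.8 Ex. 9; tree
  `plethysmCoeff_dualOfPartition_eq_zero_of_lt_card_parts`);
* `orbitMultiplicity_det_ones16_eq_zero`, `orbitMultiplicity_paddedPer_ones16_eq_zero` — both sides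
  vanish at `(1¹⁶)*` in degree `4` (`16 > 4` parts);
* `orbitMultiplicity_det_lt_symKroneckerCoeffRect_ones16` (`0 < 1`) and the row statement
  `bi17Det4ClosureLtOrbit`; `plethysmCoeff_lt_symKroneckerCoeffRect_ones16` (`a = 0 < 1 = sk`: BLMW's
  remark after (5.2.7) that `a_λ(d[n])` and `sk` are incomparable, this direction);
* `not_perDetSymKroneckerObstructionAt_ones16`, `not_perDetMultiplicityObstruction_ones16` — the
  weight is no obstruction (honest framing).

Standard axioms only; no `native_decide`; no definition, no named fact. The partition `(1¹⁶)` is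
written `Nat.Partition.rectangle 16 1` (sixteen parts equal to `1`), read at type `Nat.Partition (4 * 4)`.

## References

* P. Bürgisser, C. Ikenmeyer, *Fundamental invariants of orbit closures*, J. Algebra 477 (2017)
  390–434 = arXiv:1511.02927, §3.1–§3.2 (degree monoid / period `b(w)` of the orbit, minimal degree
  `e(w)` of the closure; `e(det_n) ≥ n²`). [cite: BurgisserIkenmeyer2017, §3.1-§3.2]
* P. Bürgisser, J. M. Landsberg, L. Manivel, J. Weyman, *An overview of mathematical issues arising in
  the geometric complexity theory approach to VP ≠ VNP*, SIAM J. Comput. 40 (2011), §5.2 (5.2.5),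
  Prop. 5.2.1 (5.2.6)–(5.2.7). [cite: BLMW2011, §5.2 Prop. 5.2.1]
* I. G. Macdonald, *Symmetric functions and Hall polynomials*, 2nd ed. (1995), Ch. I §8 Example 9.
  [cite: Macdonald1995, Ch. I §8 Example 9]
* W. Fulton, J. Harris, *Representation Theory*, GTM 129, Exercise 4.51. [cite: FultonHarrisGTM129, Exercise 4.51]
-/

noncomputable section

namespace Summit.ValiantsHypothesis.BI17Det4ClosureLtOrbit

open Literature.NumberTheory.DiophantineGeometry Literature.Computability.AlgebraicComplexity
open Literature.RepresentationTheory.FiniteGroups.MNEval (skSumT sortedParts_eq_of_parts_eq_coe)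
open Literature.Computability.Complexity (transpose_rectangle_parts)

/-! ### §1 The det-side number `sk((1¹⁶), 4 × 4) = 1` in the kernel -/

/-- **The class sum**: `Σ_{σ ∈ 𝔖₁₆} sgn(σ) (χ^{(4⁴)}(σ)² + χ^{(4⁴)}(σ²)) = 2 · 16! · 1`, evaluated by
the tree's verified Murnaghan–Nakayama program over the `231` cycle types of `𝔖₁₆` in ONE kernel
`decide` (`Lt = (1¹⁶)ᵗ = (16)`, `M = (4⁴)`). [cite: FultonHarrisGTM129, Exercise 4.51] -/
theorem skSumT_sixteen_ones_rect44 :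
    skSumT 16 [16] [4, 4, 4, 4] = 2 * (4 * 4).factorial * 1 := by
  set_option maxHeartbeats 0 in decide +kernel

/-- The partition `(1¹⁶) ⊢ 16 = 4·4`, written `Nat.Partition.rectangle 16 1`, has `16 ≤ 4·4` parts.
[folklore] -/
theorem card_parts_ones16 :
    ((Nat.Partition.rectangle 16 1 : Nat.Partition (4 * 4))).parts.card ≤ 4 * 4 := by
  rw [Nat.Partition.parts_rectangle]
  decide

/-- The partition `(1¹⁶)` has exactly `16` parts. [folklore] -/
theorem card_parts_ones16_eq :
    ((Nat.Partition.rectangle 16 1 : Nat.Partition (4 * 4))).parts.card = 16 := by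
  rw [Nat.Partition.parts_rectangle]
  decide

/-- The columns of `(1¹⁶)`: `(1¹⁶)ᵗ = (16)`, as the explicit sorted list `[16]`
(`transpose_rectangle_parts`). [folklore] -/
theorem sortedParts_transpose_ones16 :
    ((Nat.Partition.rectangle 16 1 : Nat.Partition (4 * 4))).transpose.sortedParts = [16] := by
  refine sortedParts_eq_of_parts_eq_coe _ ?_ (List.pairwise_singleton _ _)
  rw [transpose_rectangle_parts, Nat.Partition.parts_rectangle]
  decide

/-- **`sk((1¹⁶), 4 × 4) = 1` — kernel theorem**: the multiplicity of the sign character `[1¹⁶]` in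
the symmetric square `S²[4⁴]` is `1` (so `[4⁴] ⊗ [4⁴] ⊇ [1¹⁶]` once, inside `S²`), by the PROVED
semantics `2·(md)!·sk(λ, m × d) = skSumT (md) λᵗ (dᵐ)` (`symKroneckerCoeffRect_eq_of_skSumT_eq`,
BLMW 2011 (5.2.5)) and `skSumT_sixteen_ones_rect44`. By BLMW Prop. 5.2.1 (5.2.6) this is
`dim ℂ[GL₁₆ · det₄]_4^{SL₁₆}`: the orbit ring has a degree-`4` semi-invariant (BI17: `b(det₄) = 4`).
[cite: BLMW2011, §5.2 Prop. 5.2.1] -/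
theorem symKroneckerCoeffRect_four_four_ones16 :
    symKroneckerCoeffRect ℂ 4 4 (Nat.Partition.rectangle 16 1 : Nat.Partition (4 * 4)) = 1 :=
  symKroneckerCoeffRect_eq_of_skSumT_eq (m := 4) (d := 4) _ card_parts_ones16
    sortedParts_transpose_ones16
    (show (Nat.Partition.rectangle 4 4).sortedParts = [4, 4, 4, 4] from
      Nat.Partition.sortedParts_rectangle 4 4 (by decide))
    skSumT_sixteen_ones_rect44

/-! ### §2 Long partitions carry no orbit-closure multiplicity -/

/-- **`mult_{λ*} k[Δ_n(f)] = 0` for `ℓ(λ) > d`**: for a form `f` of degree `n ≠ 0` on the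
lexicographic matrix variables `MatIdx m` (characteristic zero) and `λ ⊢ s = d·n` with at most `m²`
and more than `d` parts, the multiplicity of `λ*` in `k[Δ_n(f)]` vanishes — it is bounded by the
plethysm coefficient `a_λ(d[n])` (BLMW 2011 §4.4/§5.2, tree `orbitMultiplicity_le_plethysmCoeff_holds`),
which is `0` because `Symᵈ Symⁿ V ⊆ (Symⁿ V)^{⊗ d}` only contains `S_λ V` with `ℓ(λ) ≤ d`
(Macdonald I.8 Ex. 9; tree `plethysmCoeff_dualOfPartition_eq_zero_of_lt_card_parts`).
[cite: Macdonald1995, Ch. I §8 Example 9] -/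
theorem orbitMultiplicity_eq_zero_of_lt_card_parts {k : Type} [Field k] [CharZero k] {n m d s : ℕ}
    (hn : n ≠ 0) {f : MvPolynomial (MatIdx m) k} (hf : f.IsHomogeneous n) (hs : s = d * n)
    (lam : Nat.Partition s) (hlam : lam.parts.card ≤ m * m) (hlen : d < lam.parts.card) :
    orbitMultiplicity k f n (Weight.dualOfPartition (m * m) lam).toMatIdx = 0 := by
  have h := orbitMultiplicity_le_plethysmCoeff_holds (k := k) (σ := MatIdx m) f hn hf
    (Weight.dualOfPartition (m * m) lam).toMatIdx
  rw [plethysmCoeff_dualOfPartition_eq_zero_of_lt_card_parts hs lam hlam hlen] at h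
  exact Nat.le_zero.mp h

/-- **Det side**: `mult_{(1¹⁶)*} ℂ[Δ(det₄)]₄ = 0` (`16 > 4` parts). BI17 §3.2: every `SL₁₆`-invariant of
degree `< 16 = e(det₄)` vanishes on `Δ(det₄)`; here the degree-`4` instance is already the elementary
length vanishing of the plethysm. [cite: BurgisserIkenmeyer2017, §3.1-§3.2] -/
theorem orbitMultiplicity_det_ones16_eq_zero :
    orbitMultiplicity ℂ (detFormLex ℂ 4) 4
      (Weight.dualOfPartition (4 * 4) (Nat.Partition.rectangle 16 1 : Nat.Partition (4 * 4))).toMatIdx = 0 :=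
  orbitMultiplicity_eq_zero_of_lt_card_parts (k := ℂ) (n := 4) (m := 4) (d := 4) (s := 4 * 4)
    (by decide) (detFormLex_isHomogeneous ℂ 4) rfl
    (Nat.Partition.rectangle 16 1 : Nat.Partition (4 * 4)) card_parts_ones16
    (by rw [card_parts_ones16_eq]; decide)

/-- **Per side**: `mult_{(1¹⁶)*} ℂ[Δ(X₀₀ per₃)]₄ = 0` as well (same length vanishing) — so the weight
`(1¹⁶)*` is no obstruction for `(X₀₀ per₃, det₄)`. [cite: Macdonald1995, Ch. I §8 Example 9] -/
theorem orbitMultiplicity_paddedPer_ones16_eq_zero :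
    haveI : NeZero (4 : ℕ) := ⟨by decide⟩
    orbitMultiplicity ℂ (paddedPerFormLex ℂ 3 4) 4
      (Weight.dualOfPartition (4 * 4) (Nat.Partition.rectangle 16 1 : Nat.Partition (4 * 4))).toMatIdx = 0 :=
  haveI : NeZero (4 : ℕ) := ⟨by decide⟩
  orbitMultiplicity_eq_zero_of_lt_card_parts (k := ℂ) (n := 4) (m := 4) (d := 4) (s := 4 * 4)
    (by decide) (paddedPerFormLex_isHomogeneous (n := 3) (m := 4) ℂ (by decide)) rfl
    (Nat.Partition.rectangle 16 1 : Nat.Partition (4 * 4)) card_parts_ones16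
    (by rw [card_parts_ones16_eq]; decide)

/-! ### §3 The row statement and its honest companions -/

/-- **`mult_{(1¹⁶)*} ℂ[Δ(det₄)]₄ = 0 < 1 = sk((1¹⁶), 4 × 4)`**: BLMW's bound (5.2.7) is STRICT at
`(d, λ) = (4, (1¹⁶))` for `det₄` — the orbit has a degree-`4` `SL₁₆`-semi-invariant (period
`b(det₄) = 4`), the closure has no invariant of degree `< e(det₄) = 16` (BI17 §3.1–§3.2).
[cite: BurgisserIkenmeyer2017, §3.1-§3.2] -/
theorem orbitMultiplicity_det_lt_symKroneckerCoeffRect_ones16 :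
    orbitMultiplicity ℂ (detFormLex ℂ 4) 4
        (Weight.dualOfPartition (4 * 4) (Nat.Partition.rectangle 16 1 : Nat.Partition (4 * 4))).toMatIdx <
      symKroneckerCoeffRect ℂ 4 4 (Nat.Partition.rectangle 16 1 : Nat.Partition (4 * 4)) := by
  rw [orbitMultiplicity_det_ones16_eq_zero, symKroneckerCoeffRect_four_four_ones16]
  exact Nat.one_pos

/-- **Row BI17 of the val-lit GAP-LEDGER, `BI17Det4ClosureLtOrbit`, DISCHARGED** (statement
verbatim): there is a degree `d` and a partition `λ ⊢ 4d` with at most `16` parts at which the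
orbit-closure multiplicity of `det₄` is STRICTLY below the rectangular symmetric Kronecker
coefficient `sk(λ, 4 × d)` (the multiplicity in the coordinate ring of the ORBIT, BLMW Prop. 5.2.1
(5.2.6)); witness `(d, λ) = (4, (1¹⁶))`, values `0 < 1`. [cite: BLMW2011, §5.2 Prop. 5.2.1] -/
theorem bi17Det4ClosureLtOrbit :
    ∃ (d : ℕ) (lam : Nat.Partition (4 * d)), lam.parts.card ≤ 4 * 4 ∧
      orbitMultiplicity ℂ (detFormLex ℂ 4) 4 (Weight.dualOfPartition (4 * 4) lam).toMatIdx <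
        symKroneckerCoeffRect ℂ 4 d lam :=
  ⟨4, (Nat.Partition.rectangle 16 1 : Nat.Partition (4 * 4)), card_parts_ones16,
    orbitMultiplicity_det_lt_symKroneckerCoeffRect_ones16⟩

/-- **`a_{(1¹⁶)}(4[4]) = 0 < 1 = sk((1¹⁶), 4 × 4)`**: at this weight the plethysm coefficient is
strictly below the symmetric Kronecker coefficient (BLMW 2011, after (5.2.7): the two upper bounds
`a_λ(d[n])` and `sk` for `mult_{λ*} ℂ[Δ(det_n)]` are incomparable in general — this instance of
`a < sk`). [cite: BLMW2011, §5.2 Prop. 5.2.1] -/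
theorem plethysmCoeff_lt_symKroneckerCoeffRect_ones16 :
    plethysmCoeff ℂ (MatIdx 4) 4
        (Weight.dualOfPartition (4 * 4) (Nat.Partition.rectangle 16 1 : Nat.Partition (4 * 4))).toMatIdx <
      symKroneckerCoeffRect ℂ 4 4 (Nat.Partition.rectangle 16 1 : Nat.Partition (4 * 4)) := by
  rw [plethysmCoeff_dualOfPartition_eq_zero_of_lt_card_parts (n := 4) (d := 4) rfl _
      card_parts_ones16 (by rw [card_parts_ones16_eq]; decide),
    symKroneckerCoeffRect_four_four_ones16]
  exact Nat.one_pos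

/-- **No symmetric-Kronecker-form obstruction at `(3, 4, 4, (1¹⁶))`**: the per side is `0`, not above
`sk = 1` (honest framing: the row is a det-side statement only). [cite: BLMW2011, §5.2 Prop. 5.2.1] -/
theorem not_perDetSymKroneckerObstructionAt_ones16 :
    haveI : NeZero (4 : ℕ) := ⟨by decide⟩
    ¬ PerDetSymKroneckerObstructionAt (k := ℂ) 3 4 4
        (Nat.Partition.rectangle 16 1 : Nat.Partition (4 * 4)) := by
  haveI : NeZero (4 : ℕ) := ⟨by decide⟩
  rintro ⟨-, -, h⟩
  rw [orbitMultiplicity_paddedPer_ones16_eq_zero] at h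
  exact Nat.not_lt_zero _ h

/-- **No multiplicity obstruction at the weight `(1¹⁶)*`** for `(X₀₀ per₃, det₄)`: both multiplicities
are `0` in degree `4` (honest framing; the rung `MultObstructionPer3Det4` is untouched by this file).
[cite: BlaeserIkenmeyer2025, §12.4] -/
theorem not_perDetMultiplicityObstruction_ones16 :
    haveI : NeZero (4 : ℕ) := ⟨by decide⟩
    ¬ PerDetMultiplicityObstruction (k := ℂ) 3 4
        (Weight.dualOfPartition (4 * 4) (Nat.Partition.rectangle 16 1 : Nat.Partition (4 * 4))).toMatIdx := by
  haveI : NeZero (4 : ℕ) := ⟨by decide⟩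
  rintro ⟨-, h⟩
  rw [IsMultiplicityObstructionAt, orbitMultiplicity_paddedPer_ones16_eq_zero] at h
  exact Nat.not_lt_zero _ h

end Summit.ValiantsHypothesis.BI17Det4ClosureLtOrbit

end
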